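import Summits.BirchSwinnertonDyer.BirchSwinnertonDyer.Theorems.DerivedKatoValuationDoorIntegralH1RankLeTwoOfAnalyticRankTwoRungOfFacts
import Summits.BirchSwinnertonDyer.BirchSwinnertonDyer.Theorems.DerivedKatoValuationDoorIntegralH1RankLeSelmerCorankOffDoor
import HarnessLib

/-!
# The BC5 rung of the (β) crux S2 `IntegralH1RankLeTwoOfAnalyticRankTwo` (stmt-BirchSwinnertonDyer-23752) WITHOUT the Perrin-Riou fact
# (LEAD bsd-line-dkd-p1 g5, line `birth` r6; helper, closes nothing)

g3's rung file (`…RungOfFacts`, p676247) proved the registered BC5 rung signature of line `birth`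
(`stub_rung_of_point_of_ordLeTwo`: S2 on the cells «`a = 2`, a door prime, ONE rational point of infinite order,
`ord_T L_p ≤ 2`») modulo THREE print facts {Perrin-Riou 1993 Lemme 2.3.9 `lemme239_rank_integralH1_eq_selmerCorank`,
Kato 2004 Thm. 18.4 `kato_selmerCorank_le_order_padicLFunction`, modularity `exists_isNewformOf`}, and the `(389a1, 5)`
S2-instance modulo {PR93 2.3.9, Kato 18.4 at the cell, newform + symbol DATA}.  Since then the INPUTS desk landed the `≤` half of
the dictionary as a THEOREM — at door primes (`stub_rankIntegralH1LeSelmerCorankAtDoor`, p679321) and off the door under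
`W(ℚ)[p] = 0` (`rank_integralH1_le_selmerCorank_of_torsionBy_eq_bot`, p679642).  This file re-derives the rung with the
Perrin-Riou fact DROPPED:

* §1 `rank_integralH1_le_two_of_point_of_order_le_two_of_kato` — per newform, at ANY odd good ordinary prime with `W(ℚ)[p] = 0`
  (no door, no analytic rank), modulo Kato 18.4 at `(W, p, f)` ONLY; `…_of_hasIrreducibleModPGaloisRep_of_kato` — the same under
  `ρ̄_{W,p}` irreducible.
* §2 `rung_of_point_of_ordLeTwo_of_kato_of_modularity` — the REGISTERED rung signature verbatim as conclusion, modulo {Kato 18.4,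
  modularity} (two facts instead of three): the route's BC5 certificate (tenure fit note `fit-beta2`) loses one named fact.
* §3 `rank_integralH1_le_two_389a1_five_of_kato_of_data` — the `(389a1, 5)` S2-instance modulo {Kato 18.4 at the cell, newform +
  symbol DATA}; `door_and_rank_integralH1_le_two_389a1_five_of_kato_of_data` — packaged with its (unconditional) door.
* §4 `integralH1RankLeTwoOfAnalyticRankTwo_of_ordCapTwoAtDoor_of_pointsTwo_of_facts` — position: S2 ⟸ N2∣_door ∧ `PointsTwo`
  modulo {Kato 18.4, modularity} (g3's N1∣_door ⟸ N2∣_door, ε from the point, INPUTS' dictionary-≤ at the door; route-independent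
  imports only — the same statement follows from g4's `…OfNodeItems`, which however sits in the SelmerRank theses cone).

Nothing here proves S2, N1∣_door, N2∣_door, Kato's theorem, modularity or BSD.  Helper for stmt-BirchSwinnertonDyer-23752.

References: [cite: Kato2004Asterisque, Thm. 18.4 (p. 281)]; [cite: PerrinRiou1993AIF, Lemme 2.3.9 (p. 967)];
[cite: BreuilConradDiamondTaylor2001, Thm. A]; [cite: MazurTateTeitelbaum1986Invent, §I.10–I.13]; [cite: CremonaAlgorithms1997, Table 1 (389A1)];
[cite: BlochKato1990, Ex. 3.11]; [cite: Mazur1977, Ch. III §5 (p. 157)].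
-/

set_option linter.dupNamespace false
set_option autoImplicit false

noncomputable section

open scoped MatrixGroups ModularForm Classical

namespace Summit.BirchSwinnertonDyer.BirchSwinnertonDyer.Theorems.DerivedKatoValuationDoor

open Field
open Literature Literature.NumberTheory.GaloisRepresentations
open Literature.NumberTheory.EllipticCurves Literature.NumberTheory.EllipticCurves.ModularForms
open Literature.NumberTheory.EllipticCurves.Kato2004
open Literature.NumberTheory.EllipticCurves.Kato2004.EulerSystemValues
open CongruenceSubgroup
open Summit.BirchSwinnertonDyer.BirchSwinnertonDyer.Rank2Observatory
open Summit.BirchSwinnertonDyer.BirchSwinnertonDyer.Theses.DerivedKatoValuationDoor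
  (PointsTwo IntegralH1RankLeTwoOfAnalyticRankTwo)

/-! ## §1 The rung per newform, modulo Kato 18.4 ONLY (no door, no analytic rank, no Perrin-Riou fact) -/

section PerNewform

variable (W : WeierstrassCurve ℚ) [W.IsElliptic] [W.IsGloballyMinimal] (p : ℕ) [Fact p.Prime]
  [ContinuousSMul ℤ_[p] (W.tateModule p)] {N : ℕ} [NeZero N] {f : CuspForm (Gamma0 N) 2}

/-- **The rung per newform, modulo ONE print fact.**  At an odd good ordinary prime `p` of a globally minimal `W/ℚ` with
`W(ℚ)[p] = 0`, a rational point of infinite order (`1 ≤ rank E(ℚ)`) and a newform `f` of `W` with `ord_{T=0} L_p(f, α_p; T) ≤ 2`: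
`rank_{ℤ_p} H¹(ℤ[1/p], T_pW) ≤ 2` — GIVEN Kato's Thm. 18.4 at `(W, p, f)` (`s_p ≤ ord_T L_p`).  The dictionary-≤
(`rank ≤ s_p` under ε) is INPUTS' theorem `rank_integralH1_le_selmerCorank_of_torsionBy_eq_bot` and ε_p = 1 is the theorem
`exists_integral_hasLocPKummerLog_ne_zero_of_mordellWeilRank_ne_zero` (integral Kummer class of the point); the Perrin-Riou
equality fact of `rank_integralH1_le_two_of_point_of_order_le_two_of_facts` is no longer used.
[cite: Kato2004Asterisque, Thm. 18.4 (p. 281)] [cite: PerrinRiou1993AIF, Lemme 2.3.9 (p. 967)] [cite: BlochKato1990, Ex. 3.11] -/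
theorem rank_integralH1_le_two_of_point_of_order_le_two_of_kato
    (hKato : kato_selmerCorank_le_order_padicLFunction W p (f := f)) (hp2 : p ≠ 2) (hord : IsOrdinaryAt W p)
    (hf : IsNewformOf W f) (hK : AddSubgroup.torsionBy W.toAffine.Point (p : ℤ) = ⊥) (hr : 1 ≤ W.mordellWeilRank)
    (h2 : (padicLFunction f (unitRoot W p : ℚ_[p])).order ≤ 2) :
    Module.rank ℤ_[p] ↥(integralH1 (tateRep W p) p ⊤) ≤ 2 := by
  have h1 : Module.rank ℤ_[p] ↥(integralH1 (tateRep W p) p ⊤) ≤ (W.selmerCorank p : Cardinal) :=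
    rank_integralH1_le_selmerCorank_of_torsionBy_eq_bot W p hK
      (exists_integral_hasLocPKummerLog_ne_zero_of_mordellWeilRank_ne_zero W p (by omega))
  have h2' : (W.selmerCorank p : Cardinal) ≤ 2 := by
    exact_mod_cast selmerCorank_le_two_of_order_le_two_of_kato W p hKato hp2 hord hf h2
  exact h1.trans h2'

/-- **The same under `ρ̄_{W,p}` irreducible** (⇒ `W(ℚ)[p] = 0`, `torsionBy_point_eq_bot_of_hasIrreducibleModPGaloisRep`), modulo
Kato's Thm. 18.4 at `(W, p, f)` only. [cite: Kato2004Asterisque, Thm. 18.4 (p. 281)] [cite: Mazur1977, Ch. III §5 (p. 157)] -/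
theorem rank_integralH1_le_two_of_point_of_order_le_two_of_hasIrreducibleModPGaloisRep_of_kato
    (hKato : kato_selmerCorank_le_order_padicLFunction W p (f := f)) (hp2 : p ≠ 2) (hord : IsOrdinaryAt W p)
    (hf : IsNewformOf W f) (hirr : W.HasIrreducibleModPGaloisRep p) (hr : 1 ≤ W.mordellWeilRank)
    (h2 : (padicLFunction f (unitRoot W p : ℚ_[p])).order ≤ 2) :
    Module.rank ℤ_[p] ↥(integralH1 (tateRep W p) p ⊤) ≤ 2 :=
  rank_integralH1_le_two_of_point_of_order_le_two_of_kato W p hKato hp2 hord hf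
    (torsionBy_point_eq_bot_of_hasIrreducibleModPGaloisRep W p hirr) hr h2

/-- **The same at a door prime** (`5 ≤ p`, good ordinary, `ρ̄_{W,p}` onto ⇒ `W(ℚ)[p] = 0` by `torsionBy_point_eq_bot_of_door`), modulo
Kato's Thm. 18.4 at `(W, p, f)` only. [cite: Kato2004Asterisque, Thm. 18.4 (p. 281)] -/
theorem rank_integralH1_le_two_of_point_of_order_le_two_of_door_of_kato
    (hKato : kato_selmerCorank_le_order_padicLFunction W p (f := f))
    (hdoor : 5 ≤ p ∧ IsOrdinaryAt W p ∧ W.HasSurjectiveModNGaloisRep p)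
    (hf : IsNewformOf W f) (hr : 1 ≤ W.mordellWeilRank)
    (h2 : (padicLFunction f (unitRoot W p : ℚ_[p])).order ≤ 2) :
    Module.rank ℤ_[p] ↥(integralH1 (tateRep W p) p ⊤) ≤ 2 :=
  rank_integralH1_le_two_of_point_of_order_le_two_of_kato W p hKato (by have h5 := hdoor.1; omega) hdoor.2.1 hf
    (torsionBy_point_eq_bot_of_door W p hdoor.2.2) hr h2

end PerNewform

/-! ## §2 The REGISTERED rung signature modulo {Kato 18.4, modularity} — Perrin-Riou dropped -/

/-- **The registered signature of `stub_rung_of_point_of_ordLeTwo` (line `birth`, stmt-BirchSwinnertonDyer-23752) verbatim as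
conclusion, modulo TWO print facts** {Kato Thm. 18.4 for all `(W, p, f)`, modularity}: at a door prime `p` is odd good ordinary and
`W(ℚ)[p] = 0`; modularity supplies a newform at level `N_W` (`N_W ≠ 0` by `conductorNorm_pos_holds`), the rung's own hypothesis bounds
its `ord_T L_p` by `2`, and §1 applies.  Improves `rung_of_point_of_ordLeTwo_of_facts` (three facts) by the Perrin-Riou fact.
CONDITIONAL; the two remaining facts are unproved in the tree (XL). [cite: Kato2004Asterisque, Thm. 18.4 (p. 281)]
[cite: BreuilConradDiamondTaylor2001, Thm. A] -/
theorem rung_of_point_of_ordLeTwo_of_kato_of_modularity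
    (hKato : ∀ (W : WeierstrassCurve ℚ) [W.IsElliptic] [W.IsGloballyMinimal] (p : ℕ) [Fact p.Prime]
      {N : ℕ} [NeZero N] (f : CuspForm (Gamma0 N) 2), kato_selmerCorank_le_order_padicLFunction W p (f := f))
    (hMod : exists_isNewformOf) :
    ∀ (W : WeierstrassCurve ℚ) [W.IsElliptic] [W.IsGloballyMinimal] (p : ℕ) [Fact p.Prime]
      [ContinuousSMul ℤ_[p] (W.tateModule p)], W.analyticRank = 2 →
      (5 ≤ p ∧ IsOrdinaryAt W p ∧ W.HasSurjectiveModNGaloisRep p) → 1 ≤ W.mordellWeilRank →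
      (∀ {N : ℕ} [NeZero N] (f : CuspForm (CongruenceSubgroup.Gamma0 N) 2), IsNewformOf W f →
        (padicLFunction f (unitRoot W p : ℚ_[p])).order ≤ 2) →
      Module.rank ℤ_[p] ↥(integralH1 (tateRep W p) p ⊤) ≤ 2 := by
  intro W _ _ p _ _ _ha hdoor hr hN2
  haveI : NeZero (W.conductorNorm ℤ) := ⟨(W.conductorNorm_pos_holds).ne'⟩
  obtain ⟨f, hf⟩ := hMod W
  exact rank_integralH1_le_two_of_point_of_order_le_two_of_door_of_kato W p (hKato W p f) hdoor hf hr (hN2 f hf)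

/-- **The rung OFF the door, modulo {Kato 18.4, modularity}**: for a globally minimal `W/ℚ` with a rational point of infinite order,
at ANY odd good ordinary prime `p` with `ρ̄_{W,p}` irreducible, `ord_T L_p(f) ≤ 2` for the newforms of `W` gives
`rank_{ℤ_p} H¹(ℤ[1/p], T_pW) ≤ 2` — no `5 ≤ p`, no surjectivity, no analytic rank.  CONDITIONAL on the two facts.
[cite: Kato2004Asterisque, Thm. 18.4 (p. 281)] [cite: BreuilConradDiamondTaylor2001, Thm. A] -/
theorem rank_integralH1_le_two_of_point_of_ordLeTwo_offDoor_of_kato_of_modularity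
    (hKato : ∀ (W : WeierstrassCurve ℚ) [W.IsElliptic] [W.IsGloballyMinimal] (p : ℕ) [Fact p.Prime]
      {N : ℕ} [NeZero N] (f : CuspForm (Gamma0 N) 2), kato_selmerCorank_le_order_padicLFunction W p (f := f))
    (hMod : exists_isNewformOf) :
    ∀ (W : WeierstrassCurve ℚ) [W.IsElliptic] [W.IsGloballyMinimal] (p : ℕ) [Fact p.Prime]
      [ContinuousSMul ℤ_[p] (W.tateModule p)], p ≠ 2 → IsOrdinaryAt W p → W.HasIrreducibleModPGaloisRep p →
      1 ≤ W.mordellWeilRank →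
      (∀ {N : ℕ} [NeZero N] (f : CuspForm (CongruenceSubgroup.Gamma0 N) 2), IsNewformOf W f →
        (padicLFunction f (unitRoot W p : ℚ_[p])).order ≤ 2) →
      Module.rank ℤ_[p] ↥(integralH1 (tateRep W p) p ⊤) ≤ 2 := by
  intro W _ _ p _ _ hp2 hord hirr hr hN2
  haveI : NeZero (W.conductorNorm ℤ) := ⟨(W.conductorNorm_pos_holds).ne'⟩
  obtain ⟨f, hf⟩ := hMod W
  exact rank_integralH1_le_two_of_point_of_order_le_two_of_hasIrreducibleModPGaloisRep_of_kato W p (hKato W p f) hp2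
    hord hf hirr hr (hN2 f hf)

/-! ## §3 The cell `(389a1, 5)` modulo {Kato 18.4 at the cell, newform + symbol DATA} — Perrin-Riou dropped -/

/-- **The S2-instance at `(389a1, 5)` modulo print + DATA, Perrin-Riou fact dropped**: `rank_{ℤ_5} H¹(ℤ[1/5], T_5E) ≤ 2` for
`E = 389a1`, GIVEN Kato's Thm. 18.4 at `(389a1, 5, f)` and a newform `f` of `389a1` carrying the symbol DATA of the atlas cell
(`hdata`, as in `order_padicLFunction_le_two_389a1_five`).  Kernel-side: `5` is a door prime of `389a1` (`door_389a1_five`, so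
`E(ℚ)[5] = 0`), `1 ≤ 2 ≤ rank E(ℚ)` (`two_le_mordellWeilRank_389a1`) hence ε_5 by the kernel, and D-A₂ `ord_T L_5(f) ≤ 2` from the
level-`25` Riemann sum (mod DATA).  Improves `rank_integralH1_le_two_389a1_five_of_facts` by one named fact.
[cite: Kato2004Asterisque, Thm. 18.4 (p. 281)] [cite: MazurTateTeitelbaum1986Invent, §I.10–I.13] [cite: CremonaAlgorithms1997, Table 1 (389A1)] -/
theorem rank_integralH1_le_two_389a1_five_of_kato_of_data [Fact (5 : ℕ).Prime]
    [(c389a1.e.baseChange ℚ).IsElliptic] [(c389a1.e.baseChange ℚ).IsGloballyMinimal]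
    [ContinuousSMul ℤ_[5] ((c389a1.e.baseChange ℚ).tateModule 5)]
    {N : ℕ} [NeZero N] {f : CuspForm (Gamma0 N) 2} (hf : IsNewformOf (c389a1.e.baseChange ℚ) f)
    (hKato : kato_selmerCorank_le_order_padicLFunction (c389a1.e.baseChange ℚ) 5 (f := f))
    (hdata : ∀ c ∈ c389a1.cells, c.p = 5 → ∃ D : ℚ, ‖(D : ℚ_[5])‖ = 1 ∧
      (∀ x : ℚ, ‖(ratPlusSymbol f x : ℚ_[5])‖ ≤ 1) ∧
      ∀ u : ℕ, u < 5 ^ (c.n + 1) → ¬ 5 ∣ u →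
        ratPlusSymbol f ((u : ℚ) / (5 : ℚ) ^ (c.n + 1)) = (c.tabHi.getD u 0 : ℚ) / D ∧
        ratPlusSymbol f ((u : ℚ) / (5 : ℚ) ^ c.n) = (c.tabLo.getD (u % 5 ^ c.n) 0 : ℚ) / D) :
    Module.rank ℤ_[5] ↥(integralH1 (tateRep (c389a1.e.baseChange ℚ) 5) 5 ⊤) ≤ 2 :=
  rank_integralH1_le_two_of_point_of_order_le_two_of_door_of_kato _ 5 hKato door_389a1_five hf
    (le_trans (by norm_num) two_le_mordellWeilRank_389a1) (order_padicLFunction_le_two_389a1_five hf hdata)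

/-- **The same instance packaged with its door**: at `(389a1, 5)` the door triple HOLDS (kernel) and the rank cap holds modulo
{Kato 18.4 at the cell, newform + DATA} — the crux's implication `a = 2 → door → rank ≤ 2` has a true antecedent door here and a
conclusion discharged from ONE Iwasawa-theoretic print input plus modular-symbol data. [cite: Serre1972, §2.8 Prop. 19]
[cite: Kato2004Asterisque, Thm. 18.4 (p. 281)] -/
theorem door_and_rank_integralH1_le_two_389a1_five_of_kato_of_data [Fact (5 : ℕ).Prime]
    [(c389a1.e.baseChange ℚ).IsElliptic] [(c389a1.e.baseChange ℚ).IsGloballyMinimal]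
    [ContinuousSMul ℤ_[5] ((c389a1.e.baseChange ℚ).tateModule 5)]
    {N : ℕ} [NeZero N] {f : CuspForm (Gamma0 N) 2} (hf : IsNewformOf (c389a1.e.baseChange ℚ) f)
    (hKato : kato_selmerCorank_le_order_padicLFunction (c389a1.e.baseChange ℚ) 5 (f := f))
    (hdata : ∀ c ∈ c389a1.cells, c.p = 5 → ∃ D : ℚ, ‖(D : ℚ_[5])‖ = 1 ∧
      (∀ x : ℚ, ‖(ratPlusSymbol f x : ℚ_[5])‖ ≤ 1) ∧
      ∀ u : ℕ, u < 5 ^ (c.n + 1) → ¬ 5 ∣ u →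
        ratPlusSymbol f ((u : ℚ) / (5 : ℚ) ^ (c.n + 1)) = (c.tabHi.getD u 0 : ℚ) / D ∧
        ratPlusSymbol f ((u : ℚ) / (5 : ℚ) ^ c.n) = (c.tabLo.getD (u % 5 ^ c.n) 0 : ℚ) / D) :
    (5 ≤ 5 ∧ IsOrdinaryAt (c389a1.e.baseChange ℚ) 5 ∧ (c389a1.e.baseChange ℚ).HasSurjectiveModNGaloisRep 5) ∧
      Module.rank ℤ_[5] ↥(integralH1 (tateRep (c389a1.e.baseChange ℚ) 5) 5 ⊤) ≤ 2 :=
  ⟨door_389a1_five, rank_integralH1_le_two_389a1_five_of_kato_of_data hf hKato hdata⟩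

/-! ## §4 Position: S2 from N2∣_door and `PointsTwo`, modulo {Kato 18.4, modularity} -/

/-- **S2 ⟸ N2∣_door ∧ `PointsTwo` (stmt-BirchSwinnertonDyer-23026), modulo {Kato Thm. 18.4 for all `(W, p, f)`, modularity}**:
N2∣_door («`a = 2 ⇒ ord_T L_p(f) ≤ 2` at door primes, for every newform `f` of `W`» — the order half of `p`-adic BSD at `a = 2`,
OPEN, node N2 of the S0 key) gives N1∣_door by g3's `selCapTwoAtDoor_of_ordCapTwoAtDoor_of_facts`; ε comes from a rational point
of infinite order (`crisAtDoorPrimes_of_pointsTwo`) and INPUTS' dictionary-≤ theorem `stub_rankIntegralH1LeSelmerCorankAtDoor` finishes,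
print-free.  The crux therefore sits one Kato-18.4 step below
node N2 given the route's own residual.  CONDITIONAL reduction; neither node is proved. [cite: Kato2004Asterisque, Thm. 18.4 (p. 281)]
[cite: BreuilConradDiamondTaylor2001, Thm. A] [cite: MazurTateTeitelbaum1986Invent, §II.10] -/
theorem integralH1RankLeTwoOfAnalyticRankTwo_of_ordCapTwoAtDoor_of_pointsTwo_of_facts
    (hKato : ∀ (W : WeierstrassCurve ℚ) [W.IsElliptic] [W.IsGloballyMinimal] (p : ℕ) [Fact p.Prime]
      {N : ℕ} [NeZero N] (f : CuspForm (Gamma0 N) 2), kato_selmerCorank_le_order_padicLFunction W p (f := f))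
    (hMod : exists_isNewformOf)
    (hN2 : ∀ (W : WeierstrassCurve ℚ) [W.IsElliptic] [W.IsGloballyMinimal] (p : ℕ) [Fact p.Prime],
      W.analyticRank = 2 →
        (5 ≤ p ∧ Literature.NumberTheory.EllipticCurves.IsOrdinaryAt W p ∧ W.HasSurjectiveModNGaloisRep p) →
          ∀ {N : ℕ} [NeZero N] (f : CuspForm (Gamma0 N) 2), IsNewformOf W f →
            (padicLFunction f (unitRoot W p : ℚ_[p])).order ≤ 2)
    (hPts : PointsTwo) : IntegralH1RankLeTwoOfAnalyticRankTwo := by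
  intro W _ _ p _ _ ha hdoor
  have hSel : W.selmerCorank p ≤ 2 := selCapTwoAtDoor_of_ordCapTwoAtDoor_of_facts hKato hMod hN2 W p ha hdoor
  have h1 : Module.rank ℤ_[p] ↥(integralH1 (tateRep W p) p ⊤) ≤ (W.selmerCorank p : Cardinal) :=
    stub_rankIntegralH1LeSelmerCorankAtDoor W p hdoor (crisAtDoorPrimes_of_pointsTwo hPts W p ha hdoor)
  have h2 : (W.selmerCorank p : Cardinal) ≤ 2 := by exact_mod_cast hSel
  exact h1.trans h2

end Summit.BirchSwinnertonDyer.BirchSwinnertonDyer.Theorems.DerivedKatoValuationDoor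

end
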